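import Mathlib
import HarnessLib
import Literature.Analysis.FluidPDE.SteadyLiouvilleTsaiKit
import Summits.NavierStokesRegularity.NavierStokesRegularity.Theorems.PoloidalWindowDoorLrcModEntireTwistingTHPlaneOscillation
import Summits.NavierStokesRegularity.NavierStokesRegularity.Theorems.PoloidalWindowDoorPoloidalWindowRigidityTimeHeightShearLinearSlice

/-!
# Item `LrcModEntire` (stmt-NavierStokesRegularity-20428), skeleton twist_split v6, (TH) column — brick B3 of the LEAD ns-poloidal-K2-p3 g12:
# the vertical flux of the WAVE LAGRANGIAN `ℒ = ½(|vₕ|² + μ v₂²)` on the stratum (TH) (NORMALFORM-TH-g12 §2, identity (E5), in the tree's `v`-currency)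

Cell ns-regularity-ideate, seat ns-k2-port-2 g3 (`--supports stmt-NavierStokesRegularity-20428 --as helper`; sequel of p680971/p681808/p682322).
In the LEAD's potential variables (`vₕ = ∇ₕψ`, `v₂ = νψ_z`, `ν = 1/μ`) the wave Lagrangian of the slice constraint (K) is `ℒ = ½(|∇ₕψ|² + νψ_z²) =
½(|vₕ|² + μ v₂²)`; (E5) says that its height derivative is a functional of `v₂` ALONG THE VERTICAL LINE plus a height-only term.  Here, division-free and
without the potential:

* `fderiv_vert_waveLagrangian` — KINEMATIC, at one point of (TH): `∂₂ℒ = μ·(v·∇v₂) + ½μ_z v₂²` (the only horizontal coupling `vₕ·∂₂vₕ` becomes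
  `μ vₕ·∇ₕv₂` by the shear identities);
* `fderiv_vert_waveLagrangian_eq` — with the vertical momentum equation (`v·∇v₂ = f₂ − ∂ₜv₂ + Δv₂`, `…SlopeFunctionPressure.material_vert_eq_residual`)
  and the linear slice identity of (TH) (`μΔv₂ = (μ−1)∂₂∂₂v₂`, `…TimeHeightShearLinearSlice.plane_wave_identity`):
  `∂₂ℒ = μ f₂ − μ ∂ₜv₂ + (μ − 1)∂₂∂₂v₂ + ½μ_z v₂²`;
* `fderiv_vert_waveLagrangian_weighted` — (E5): multiplying by `1 − μ` and inserting the doubled weight source `2𝒜 = 2(1−μ)f₂ − 2(μ_t−μ_zz)v₂ − μ_zv₂² +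
  4μ_z∂₂v₂` (horizontally constant: `…TwistingTHPlaneOscillation.weightSource_eq_of_height_eq`):
  `(1−μ)∂₂ℒ = μ·𝒜 + μ(μ_t−μ_zz)v₂ + (μμ_z/2)v₂² − 2μμ_z∂₂v₂ − μ(1−μ)∂ₜv₂ − (1−μ)²∂₂∂₂v₂ + ½(1−μ)μ_z v₂²` — height-only + vertical-line functional.

WHAT THIS IS NOT: not a claim about Navier–Stokes regularity and not the stub — an exact identity of the stratum (TH), a cross-check currency for (TH) exports
(bears_on LADDER-NS N0, item 20428 / crux 19708).
-/

noncomputable section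

-- the summit and its single sub-problem share the name (CONVENTIONS §1), as in every Theorems file
set_option linter.dupNamespace false

namespace Summit.NavierStokesRegularity.NavierStokesRegularity.Theorems.PoloidalWindowDoorLrcModEntireTwistingTHWaveLagrangian

open MeasureTheory Set Function Filter Topology Metric InnerProductSpace
open scoped RealInnerProductSpace InnerProductSpace Laplacian ContDiff
open Literature.Analysis Literature.Analysis.FluidPDE
open Summit.NavierStokesRegularity.NavierStokesRegularity.Theorems.LocalSineTubeDoorProfileAlignedWindowRigidityAncient
open Summit.NavierStokesRegularity.NavierStokesRegularity.Theorems.PoloidalWindowDoorPoloidalWindowRigidityWindow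
open Summit.NavierStokesRegularity.NavierStokesRegularity.Theorems.PoloidalWindowDoorPoloidalWindowRigidityFlat
open Summit.NavierStokesRegularity.NavierStokesRegularity.Theorems.PoloidalWindowDoorPoloidalWindowRigidityConstantShearSlice
open Summit.NavierStokesRegularity.NavierStokesRegularity.Theorems.PoloidalWindowDoorPoloidalWindowRigidityClebsch
open Summit.NavierStokesRegularity.NavierStokesRegularity.Theorems.PoloidalWindowDoorPoloidalWindowRigidityTimeHeightShearPressure
open Summit.NavierStokesRegularity.NavierStokesRegularity.Theorems.PoloidalWindowDoorPoloidalWindowRigiditySlopeFunctionPressure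
open Summit.NavierStokesRegularity.NavierStokesRegularity.Theorems.PoloidalWindowDoorPoloidalWindowRigidityTimeHeightShearLinearSlice
open Summit.NavierStokesRegularity.NavierStokesRegularity.Theorems.PoloidalWindowDoorLrcModEntireTwistingTHPlaneOscillation

/-! ### Kinematic part: a generic field on a proportional-shear point -/

section Kinematic

variable {V : EuclideanSpace ℝ (Fin 3) → EuclideanSpace ℝ (Fin 3)} {m : ℝ → ℝ} {x : EuclideanSpace ℝ (Fin 3)}

/-- **`∂₂ℒ = μ·(V·∇V₂) + ½μ′V₂²` at a proportional-shear point.**  For a `C¹` field `V` and a `C¹` slope profile `m` of the height with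
`∂₂V_b(x) = m(x₂)∂_bV₂(x)` (`b = 0,1`) at the point `x`:
`∂₂[½(V₀² + V₁² + m(·₂)V₂²)](x) = m(x₂)·DV₂(x)(V(x)) + ½m′(x₂)V₂(x)²`. -/
theorem fderiv_vert_waveLagrangian_field (hV : ContDiff ℝ 1 V) (hm : ContDiff ℝ 1 m)
    (hTH : ∀ b : Fin 3, b ≠ 2 →
      fderiv ℝ V x (EuclideanSpace.single 2 1) b = m (x 2) * fderiv ℝ V x (EuclideanSpace.single b 1) 2) :
    fderiv ℝ (fun y => (1 / 2 : ℝ) * (V y 0 * V y 0 + V y 1 * V y 1 + m (y 2) * (V y 2 * V y 2))) x (EuclideanSpace.single 2 1) =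
      m (x 2) * fderiv ℝ (fun y => V y 2) x (V x) + (1 / 2 : ℝ) * deriv m (x 2) * V x 2 ^ 2 := by
  have hc : ∀ i : Fin 3, ContDiff ℝ 1 (fun y => V y i) := fun i =>
    (EuclideanSpace.proj (𝕜 := ℝ) i : EuclideanSpace ℝ (Fin 3) →L[ℝ] ℝ).contDiff.comp hV
  have hmh : ContDiff ℝ 1 (fun y : EuclideanSpace ℝ (Fin 3) => m (y 2)) := contDiff_comp_height hm
  have hcd : ∀ i : Fin 3, Differentiable ℝ (fun y => V y i) := fun i => (hc i).differentiable (by norm_num)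
  have hVd : Differentiable ℝ V := hV.differentiable (by norm_num)
  set e₂ : EuclideanSpace ℝ (Fin 3) := EuclideanSpace.single 2 (1 : ℝ) with he₂
  -- the three products
  have hp0 : ContDiff ℝ 1 (fun y => V y 0 * V y 0) := (hc 0).mul (hc 0)
  have hp1 : ContDiff ℝ 1 (fun y => V y 1 * V y 1) := (hc 1).mul (hc 1)
  have hp22 : ContDiff ℝ 1 (fun y => V y 2 * V y 2) := (hc 2).mul (hc 2)
  have hp2 : ContDiff ℝ 1 (fun y : EuclideanSpace ℝ (Fin 3) => m (y 2) * (V y 2 * V y 2)) := hmh.mul hp22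
  have hsum : ContDiff ℝ 1 (fun y : EuclideanSpace ℝ (Fin 3) => V y 0 * V y 0 + V y 1 * V y 1 + m (y 2) * (V y 2 * V y 2)) :=
    (hp0.add hp1).add hp2
  have d0 := Tsai2021.pd_mul_apply (hc 0) (hc 0) x e₂
  have d1 := Tsai2021.pd_mul_apply (hc 1) (hc 1) x e₂
  have d22 := Tsai2021.pd_mul_apply (hc 2) (hc 2) x e₂
  have d2 := Tsai2021.pd_mul_apply hmh hp22 x e₂
  have dm : fderiv ℝ (fun y : EuclideanSpace ℝ (Fin 3) => m (y 2)) x e₂ = deriv m (x 2) := by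
    rw [he₂, fderiv_comp_height_apply ((hm.differentiable (by norm_num)) (x 2))]; simp
  -- assemble `∂₂` of the sum
  have hL : fderiv ℝ (fun y => (1 / 2 : ℝ) * (V y 0 * V y 0 + V y 1 * V y 1 + m (y 2) * (V y 2 * V y 2))) x e₂ =
      (1 / 2 : ℝ) * (2 * V x 0 * fderiv ℝ (fun y => V y 0) x e₂ + 2 * V x 1 * fderiv ℝ (fun y => V y 1) x e₂
        + (m (x 2) * (2 * V x 2 * fderiv ℝ (fun y => V y 2) x e₂) + V x 2 * V x 2 * deriv m (x 2))) := by
    have hsd : DifferentiableAt ℝ (fun y : EuclideanSpace ℝ (Fin 3) => V y 0 * V y 0 + V y 1 * V y 1 + m (y 2) * (V y 2 * V y 2)) x :=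
      (hsum.differentiable (by norm_num)) x
    rw [fderiv_const_mul hsd]
    simp only [FunLike.coe_smul, Pi.smul_apply, smul_eq_mul]
    have hadd1 : DifferentiableAt ℝ (fun y => V y 0 * V y 0 + V y 1 * V y 1) x :=
      ((hp0.add hp1).differentiable (by norm_num)) x
    rw [fderiv_fun_add hadd1 ((hp2.differentiable (by norm_num)) x),
      fderiv_fun_add ((hp0.differentiable (by norm_num)) x) ((hp1.differentiable (by norm_num)) x)]
    simp only [FunLike.coe_add, Pi.add_apply]
    rw [d0, d1, d2, d22, dm]
    ring
  rw [hL]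
  -- the shear identities turn `V_b ∂₂V_b` into `μ V_b ∂_bV₂`
  have h0 : fderiv ℝ (fun y => V y 0) x e₂ = m (x 2) * fderiv ℝ (fun y => V y 2) x (EuclideanSpace.single 0 1) := by
    rw [FluidPDE.fderiv_apply_coord (hVd x) e₂ 0, he₂, hTH 0 (by decide),
      ← FluidPDE.fderiv_apply_coord (hVd x) (EuclideanSpace.single 0 1) 2]
  have h1 : fderiv ℝ (fun y => V y 1) x e₂ = m (x 2) * fderiv ℝ (fun y => V y 2) x (EuclideanSpace.single 1 1) := by
    rw [FluidPDE.fderiv_apply_coord (hVd x) e₂ 1, he₂, hTH 1 (by decide),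
      ← FluidPDE.fderiv_apply_coord (hVd x) (EuclideanSpace.single 1 1) 2]
  rw [h0, h1, fderiv_apply_eq_sum_coord (G := fun y => V y 2) (V x), Fin.sum_univ_three, he₂]
  ring

end Kinematic

/-! ### The class setting -/

section Class

variable {C : ℝ} {v : ℝ → EuclideanSpace ℝ (Fin 3) → EuclideanSpace ℝ (Fin 3)}
variable (hrate : HasTypeITimeDecay C v) (hcont : ContinuousOn (uncurry v) (Iio (0 : ℝ) ×ˢ univ))
  (hmild : ∀ s t : ℝ, s < t → t < 0 → ∀ x,
    v t x = UnboundedOperators.heatExtension (v s) (t - s) x - oseenDuhamel 1 s v v t x)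
  (hdiv : ∀ t < 0, VectorCalculus.IsDivFree (v t))

include hrate hcont hmild hdiv

omit hdiv in
/-- **B3, kinematic**: on (TH) at the point `(t,x)` (slope profile `μ(t,·)` of class `C¹`),
`∂₂[½(v₀² + v₁² + μ(t,·₂)v₂²)](t,x) = μ(t,x₂)·Dv₂(t,x)(v(t,x)) + ½μ_z(t,x₂)v₂(t,x)²`. -/
theorem fderiv_vert_waveLagrangian {μ : ℝ → ℝ → ℝ} {t : ℝ} (hμt : ContDiff ℝ 1 (μ t)) (ht : t < 0)
    {x : EuclideanSpace ℝ (Fin 3)}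
    (hTH : ∀ b : Fin 3, b ≠ 2 →
      fderiv ℝ (v t) x (EuclideanSpace.single 2 1) b = μ t (x 2) * fderiv ℝ (v t) x (EuclideanSpace.single b 1) 2) :
    fderiv ℝ (fun y => (1 / 2 : ℝ) * (v t y 0 * v t y 0 + v t y 1 * v t y 1 + μ t (y 2) * (v t y 2 * v t y 2))) x
        (EuclideanSpace.single 2 1) =
      μ t (x 2) * fderiv ℝ (fun y => v t y 2) x (v t x) + (1 / 2 : ℝ) * deriv (μ t) (x 2) * v t x 2 ^ 2 :=
  fderiv_vert_waveLagrangian_field ((contDiff_slice hrate hcont hmild ht).of_le (by norm_cast)) hμt hTH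

/-- **B3, dynamic**: on a plane `{y₂ = x₂}` of the slice `t < 0` which is proportional-shear with slope `μ(t,x₂)` (the whole plane, as in the
(TH) normal form), `∂₂ℒ(t,x) = μ f₂ − μ ∂ₜv₂ + (μ−1)∂₂∂₂v₂ + ½μ_z v₂²` with `f₂` the vertical component of the intrinsic residual (`= −∂₂p`). -/
theorem fderiv_vert_waveLagrangian_eq {μ : ℝ → ℝ → ℝ} {t : ℝ} (hμt : ContDiff ℝ 1 (μ t)) (ht : t < 0)
    {x : EuclideanSpace ℝ (Fin 3)}
    (hplane : ∀ y : EuclideanSpace ℝ (Fin 3), y 2 = x 2 → ∀ b : Fin 3, b ≠ 2 →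
      fderiv ℝ (v t) y (EuclideanSpace.single 2 1) b = μ t (x 2) * fderiv ℝ (v t) y (EuclideanSpace.single b 1) 2) :
    fderiv ℝ (fun y => (1 / 2 : ℝ) * (v t y 0 * v t y 0 + v t y 1 * v t y 1 + μ t (y 2) * (v t y 2 * v t y 2))) x
        (EuclideanSpace.single 2 1) =
      μ t (x 2) * (timeDerivWithin (Iio 0) v t x + convect (v t) (v t) x - Δ (v t) x) 2
        - μ t (x 2) * deriv (fun s => v s x 2) t
        + (μ t (x 2) - 1) * fderiv ℝ (fun y => fderiv ℝ (fun y' => v t y' 2) y (EuclideanSpace.single 2 1)) x (EuclideanSpace.single 2 1)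
        + (1 / 2 : ℝ) * deriv (μ t) (x 2) * v t x 2 ^ 2 := by
  have hTH : ∀ b : Fin 3, b ≠ 2 →
      fderiv ℝ (v t) x (EuclideanSpace.single 2 1) b = μ t (x 2) * fderiv ℝ (v t) x (EuclideanSpace.single b 1) 2 :=
    hplane x rfl
  rw [fderiv_vert_waveLagrangian hrate hcont hmild hμt ht hTH]
  -- vertical momentum: `v·∇v₂ = f₂ − ∂ₜv₂ + Δv₂`
  have hmom := material_vert_eq_residual hrate hcont hmild hdiv ht x
  -- the linear slice identity: `∂₂∂₂v₂ = −μ(∂₀∂₀v₂ + ∂₁∂₁v₂)`, hence `μΔv₂ = (μ−1)∂₂∂₂v₂`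
  have hu : ContDiff ℝ 2 (v t) := (contDiff_slice hrate hcont hmild ht).of_le (by norm_cast)
  have hpw := plane_wave_identity (c := x 2) hu (fun y => div_coord (hdiv t ht) y) hplane rfl
  have hθ2 : ContDiff ℝ 2 (fun y => v t y 2) := (contDiff_vert_slice hrate hcont hmild hdiv ht).of_le (by norm_cast)
  have hlap := Tsai2021.laplacian_eq_sum_three hθ2 x
  rw [Fin.sum_univ_three] at hlap
  have hconv : fderiv ℝ (fun y => v t y 2) x (v t x) =
      (timeDerivWithin (Iio 0) v t x + convect (v t) (v t) x - Δ (v t) x) 2 - deriv (fun s => v s x 2) t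
        + Δ (fun y => v t y 2) x := by linarith
  rw [hconv, hlap, hpw]
  ring

/-- **B3 = (E5): the weighted vertical flux of the wave Lagrangian is height-only plus a vertical-line functional of `v₂`.**  With the doubled weight
source `2𝒜(t,x) := 2(1−μ)f₂ − 2(μ_t − μ_zz)v₂ − μ_z v₂² + 4μ_z∂₂v₂` (constant on the plane by `weightSource_eq_of_height_eq`):
`(1−μ)·∂₂ℒ = μ·𝒜 + μ(μ_t − μ_zz)v₂ + (μμ_z/2)v₂² − 2μμ_z∂₂v₂ − μ(1−μ)∂ₜv₂ − (1−μ)²∂₂∂₂v₂ + ½(1−μ)μ_z v₂²` — stated with `2𝒜` written out. -/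
theorem fderiv_vert_waveLagrangian_weighted {μ : ℝ → ℝ → ℝ} {t : ℝ} (hμt : ContDiff ℝ 1 (μ t)) (ht : t < 0)
    {x : EuclideanSpace ℝ (Fin 3)}
    (hplane : ∀ y : EuclideanSpace ℝ (Fin 3), y 2 = x 2 → ∀ b : Fin 3, b ≠ 2 →
      fderiv ℝ (v t) y (EuclideanSpace.single 2 1) b = μ t (x 2) * fderiv ℝ (v t) y (EuclideanSpace.single b 1) 2) :
    (1 - μ t (x 2)) *
        fderiv ℝ (fun y => (1 / 2 : ℝ) * (v t y 0 * v t y 0 + v t y 1 * v t y 1 + μ t (y 2) * (v t y 2 * v t y 2))) x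
          (EuclideanSpace.single 2 1) =
      μ t (x 2) / 2 *
          (2 * (1 - μ t (x 2)) * (timeDerivWithin (Iio 0) v t x + convect (v t) (v t) x - Δ (v t) x) 2
            - 2 * (deriv (fun s => μ s (x 2)) t - deriv (deriv (μ t)) (x 2)) * v t x 2
            - deriv (μ t) (x 2) * v t x 2 ^ 2
            + 4 * deriv (μ t) (x 2) * fderiv ℝ (v t) x (EuclideanSpace.single 2 1) 2)
        + μ t (x 2) * (deriv (fun s => μ s (x 2)) t - deriv (deriv (μ t)) (x 2)) * v t x 2
        + μ t (x 2) * deriv (μ t) (x 2) / 2 * v t x 2 ^ 2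
        - 2 * μ t (x 2) * deriv (μ t) (x 2) * fderiv ℝ (v t) x (EuclideanSpace.single 2 1) 2
        - μ t (x 2) * (1 - μ t (x 2)) * deriv (fun s => v s x 2) t
        - (1 - μ t (x 2)) ^ 2 *
            fderiv ℝ (fun y => fderiv ℝ (fun y' => v t y' 2) y (EuclideanSpace.single 2 1)) x (EuclideanSpace.single 2 1)
        + (1 / 2 : ℝ) * (1 - μ t (x 2)) * deriv (μ t) (x 2) * v t x 2 ^ 2 := by
  rw [fderiv_vert_waveLagrangian_eq hrate hcont hmild hdiv hμt ht hplane]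
  ring

end Class

end Summit.NavierStokesRegularity.NavierStokesRegularity.Theorems.PoloidalWindowDoorLrcModEntireTwistingTHWaveLagrangian
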